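import Summits.KontsevichZagierPeriods.KontsevichZagierPeriods.Theorems.LinRedNormalFormHoffmanSpanInKZSpanTransfer
import Summits.KontsevichZagierPeriods.KontsevichZagierPeriods.Theorems.FurushoPentagonKernelModuloPeriodConjectureLeafWeightLeSeventeen
import Summits.KontsevichZagierPeriods.KontsevichZagierPeriods.Theorems.FurushoPentagonKernelModuloPeriodConjectureMzvSectorLeafOn
import Summits.KontsevichZagierPeriods.KontsevichZagierPeriods.Theorems.FurushoPentagonIntegerDivision

/-!
# Crux `LinRedNormalForm.HoffmanSpanInKZ` (stmt-KontsevichZagierPeriods-15044) — line `assoc-smooth`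

Strategist's ALTERNATIVE line (strengthen lens applied to line `assoc-reduced`): the summit-flavoured
stub `ReducedPeriodRing` (a property of the UNKNOWN ring `P = FormalRep ⧸ relations`) is replaced by a
property of a KNOWN `ℚ`-scheme — the (weight-truncated) PENTAGON SCHEME `M_pent = {φ group-like,
Drinfeld pentagon}`: identities of leaf shape that hold at all its points over REDUCED commutative
`ℚ`-algebras hold at ALL its points (`LeafTransfer`).  This is implied by REDUCEDNESS of `M_pent`, and
`M_pent` should even be SMOOTH: set-theoretically `M_pent = ⋃_μ M_μ ⊔ GRT₁` (Furusho 2010: pentagon ⇒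
hexagons with `μ = ±√(24 c₂)`; `μ = 0` gives `GRT₁`); an EVEN rational associator `Φ^{ev}` (Rossi–
Willwacher: `Φ_AT` is even; descent to `ℚ` by triviality of torsors under pro-unipotent groups) gives the
algebraic family `t ↦ Φ^{ev}(√t X₀, √t X₁)` (polynomial in `t`), hence a bijective `GRT₁`-equivariant
morphism `𝔸¹ × GRT₁ → M_pent`; the tangent space of `M_pent` at `φ = 1` is `{ψ primitive : linearised
pentagon} = ℚ·[X₀,X₁] ⊕ 𝔤𝔯𝔱₁` by Furusho's infinitesimal pentagon theorem (5-cycle ⇒ 2- and 3-cycle in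
degree `≥ 3`) and the weight-1 vanishing (`Associators.lean` §7), i.e. of the dimension of `𝔸¹ × GRT₁`;
smoothness propagates from the fibre `c₂ = 0` by the `GRT₁`- and `𝔾_m`-actions (every `𝔾_m`-orbit
closure meets `φ = 1`).  A smooth scheme is reduced, and a regular function on a reduced affine
`ℚ`-scheme of finite type vanishing at all `K̄`-points vanishes identically — whence `LeafTransfer`.

With `LeafTransfer`, the associator leaf (landed for weights `≤ 17`, `𝔤𝔯𝔱₁ = 𝔤ᵐ`-grade beyond) is read at
`(P_ℚ, Φ_P)` with NO hypothesis on `P` (`PentagonInKZ` is a tree theorem), and descends to the crux as in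
line `assoc-reduced` (bridge PROVED below).  Net: `HoffmanSpanInKZ ⇐ LeafTransfer (pure algebra,
theorem-grade, L–XL) ∧ associator leaf in weights ≥ 18 (Drinfeld–Ihara–Deligne-grade, weaker than IKZ
Conj. 1) ∧ PentagonInKZ (tree theorem, stubbed only for the import clash recorded in line assoc-reduced)`.

Sources: V. Drinfeld, Leningrad Math. J. 2 (1991) §5 (torsor structure, Prop. 5.9); H. Furusho, Ann. of
Math. 171 (2010) Thm 1 + Lie version (tree: `furusho_pentagon_hexagon_holds`); Ann. of Math. 174 (2011);
D. Bar-Natan, Selecta Math. 4 (1998); C. Rossi, T. Willwacher, arXiv:1404.2047 (evenness of `Φ_AT`);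
A. Alekseev, C. Torossian, Ann. of Math. 175 (2012), arXiv:0802.4300; F. Brown, Ann. of Math. 175 (2012);
K. Ihara, M. Kaneko, D. Zagier, Compos. Math. 142 (2006) Conj. 1.
-/

noncomputable section

namespace Summit.KontsevichZagierPeriods.KontsevichZagierPeriods.Cruxes.HoffmanSpanInKZ.AssocSmooth

open Literature.NumberTheory.Transcendental
open Literature.NumberTheory.Transcendental.KZ
open Summit.KontsevichZagierPeriods.MzvKernelInKZ.Negative
open Summit.KontsevichZagierPeriods.MzvKernelInKZ.TwoPosets
open Summit.KontsevichZagierPeriods.LinRedNormalForm.HoffmanSpanInKZ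
  (hoffmanGens SpanAt hoffmanSpanInKZ_iff zWord_bword_mem_hoffmanGens)
open Summit.KontsevichZagierPeriods.KontsevichZagierPeriods.Theses.FurushoPentagon (PentagonInKZ)
open Summit.KontsevichZagierPeriods.KontsevichZagierPeriods.Theses.LinRedNormalForm (HoffmanSpanInKZ)
open Summit.KontsevichZagierPeriods.FurushoPentagon.PentagonInKZNegative (pentagonInKZ_iff_rulesAssociator)
open Summit.KontsevichZagierPeriods.FurushoPentagon.KernelModuloPeriodConjecture
  (isGroupLike_rulesAssociator formalSpan_neg_one_pow_mul sectorKernel_toPeriodAlgebra_injective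
    stub_associatorHoffmanSpanning_of_weight_le_17)

/-- The associator Hoffman-spanning LEAF at one admissible index `s` (verbatim the body of
`FurushoPentagon.KernelModuloPeriodConjecture.stub_associatorHoffmanSpanning_of_weight_le_17`): one
finitely supported `b` on Hoffman indices of the weight of `s` with `c_{bw s}(φ) = Σ_t b_t c_{bw t}(φ)`
at every group-like solution `φ` of Drinfeld's pentagon over every reduced commutative `ℚ`-algebra. -/
def LeafAt (s : List ℕ) : Prop :=
  ∃ b : List ℕ →₀ ℚ, (∀ t ∈ b.support, MZV.IsHoffman t ∧ MZV.weight t = MZV.weight s) ∧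
    ∀ (R : Type) [CommRing R] [Algebra ℚ R] [IsReduced R] (φ : NCSeries Bool R),
      NCSeries.IsGroupLike φ → NCSeries.DrinfeldPentagon φ →
        φ (MZV.binaryWord s) = b.sum (fun t q => q • φ (MZV.binaryWord t))

/-! ## Registered stubs -/

/-- **Leaf transfer** (the content of "the truncated pentagon scheme is reduced", in the shape it is
consumed): a Hoffman expansion of `c_{bw s}` valid at every group-like pentagon solution over every
REDUCED commutative `ℚ`-algebra is valid at every group-like pentagon solution over EVERY commutative
`ℚ`-algebra. -/
def LeafTransfer : Prop :=
  ∀ (s : List ℕ) (b : List ℕ →₀ ℚ),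
    (∀ (R : Type) [CommRing R] [Algebra ℚ R] [IsReduced R] (φ : NCSeries Bool R),
      NCSeries.IsGroupLike φ → NCSeries.DrinfeldPentagon φ →
        φ (MZV.binaryWord s) = b.sum (fun t q => q • φ (MZV.binaryWord t))) →
    ∀ (R : Type) [CommRing R] [Algebra ℚ R] (φ : NCSeries Bool R),
      NCSeries.IsGroupLike φ → NCSeries.DrinfeldPentagon φ →
        φ (MZV.binaryWord s) = b.sum (fun t q => q • φ (MZV.binaryWord t))

/-- Stub 1 (THEOREM-GRADE, pure algebra, L–XL): leaf transfer from reduced to arbitrary coefficient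
algebras — reducedness (indeed smoothness) of the weight-truncated pentagon scheme `{group-like,
pentagon}` (Drinfeld's torsor theorem + Furusho's infinitesimal pentagon theorem + an even rational
associator). -/
theorem stub_leafTransfer : LeafTransfer := by
  sorry

/-- Stub 2 (THE OPEN TAIL of this line): the associator Hoffman-spanning leaf in every weight `≥ 18`
(coordinate form of `𝔤𝔯𝔱₁ ≅ 𝔤ᵐ` weight by weight; decidable per weight by the `LinEDS` block certificates of
route FurushoPentagon, whose weight-18 tables are in flight). -/
theorem stub_assocTailT :
    ∀ s : List ℕ, MZV.IsAdmissible s → 18 ≤ MZV.weight s → LeafAt s := by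
  sorry

/-- Stub 3 (A TREE THEOREM, `FurushoPentagon.PentagonInKZ.PentagonInKZ_of`; stubbed ONLY because its
module cannot be co-imported with the leaf files — duplicate declaration `NCSeries.push_ofFn` in the two
Literature closures; closing it = that rename): the rules associator satisfies Drinfeld's pentagon. -/
theorem stub_pentagonInKZ : PentagonInKZ := by
  sorry

/-! ## G1 with the weight kept, without reducedness of `P` -/

/-- Under `PentagonInKZ` and `LeafTransfer`, the leaf at an admissible `s`, transferred to arbitrary
coefficient algebras and read at the rules associator `Φ_P ∈ P_ℚ⟨⟨X₀,X₁⟩⟩` (NO hypothesis on `P`), gives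
`1 ⊗ ⟦ζ(s)⟧ ∈ span_ℚ {1 ⊗ ⟦ζ(t)⟧ : t Hoffman, |t| = |s|}`. [cite: Furusho2011, Thm 1.2] -/
theorem formalSpanW_of_leafAt (hP : PentagonInKZ) (hT : LeafTransfer) {s : List ℕ}
    (hs : MZV.IsAdmissible s) (hA : LeafAt s) :
    toPeriodAlgebra (mzvClass s) ∈ Submodule.span ℚ (Set.range
      (fun t : {t : List ℕ // MZV.IsHoffman t ∧ MZV.weight t = MZV.weight s} =>
        toPeriodAlgebra (mzvClass t.1))) := by
  have hPent : NCSeries.DrinfeldPentagon rulesAssociator := pentagonInKZ_iff_rulesAssociator.mp hP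
  obtain ⟨b, hb, hall⟩ := hA
  have key := hT s b hall FormalPeriodAlgebra rulesAssociator isGroupLike_rulesAssociator hPent
  rw [rulesAssociator_binaryWord hs] at key
  have hx : toPeriodAlgebra (mzvClass s) =
      (-1 : FormalPeriodAlgebra) ^ MZV.depth s *
        b.sum (fun t q => q • rulesAssociator (MZV.binaryWord t)) := by
    rw [← key, ← mul_assoc, ← pow_add, ← two_mul, pow_mul, neg_one_sq, one_pow, one_mul]
  rw [hx, formalSpan_neg_one_pow_mul]
  refine Submodule.smul_mem _ _ ?_
  rw [Finsupp.sum]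
  refine Submodule.sum_mem _ fun t ht => ?_
  have hH : MZV.IsHoffman t := (hb t ht).1
  rw [rulesAssociator_binaryWord hH.isAdmissible, formalSpan_neg_one_pow_mul]
  refine Submodule.smul_mem _ _ (Submodule.smul_mem _ _ (Submodule.subset_span ?_))
  exact ⟨⟨t, hH, (hb t ht).2⟩, rfl⟩

/-! ## Descent from `P_ℚ` to the crux's `ℤ`-form -/

/-- A finite family of rationals has a common denominator. [folklore] -/
theorem exists_common_den {ι : Type*} (S : Finset ι) (c : ι → ℚ) :
    ∃ D : ℕ, 0 < D ∧ ∀ i ∈ S, ∃ a : ℤ, (a : ℚ) = (D : ℚ) * c i := by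
  classical
  refine ⟨∏ i ∈ S, (c i).den, Finset.prod_pos fun i _ => (c i).den_pos, fun i hi => ?_⟩
  obtain ⟨k, hk⟩ := Finset.dvd_prod_of_mem (fun i => (c i).den) hi
  refine ⟨(k : ℤ) * (c i).num, ?_⟩
  rw [hk]
  push_cast
  rw [mul_comm ((c i).den : ℚ) (k : ℚ), mul_assoc, Rat.den_mul_eq_num]

/-- Natural multiples of a word class: `n • ⟦[Δ, c·ω_ε]⟧ = ⟦[Δ, (n c)·ω_ε]⟧` (integrand additivity). -/
theorem nsmul_mk_zWord {N : ℕ} (ε : Fin N → Bool) (c : ℚ) (n : ℕ) :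
    n • (QuotientAddGroup.mk (zWord N ε c) : KZ.FormalRep ⧸ KZ.relations) =
      QuotientAddGroup.mk (zWord N ε (n * c)) := by
  induction n with
  | zero => rw [zero_nsmul, Nat.cast_zero, zero_mul, mk_zWord_zero]
  | succ n ih => rw [succ_nsmul, ih, Nat.cast_succ, add_mul, one_mul, mk_zWord_add]

/-- Integer multiples of a word class. -/
theorem zsmul_mk_zWord {N : ℕ} (ε : Fin N → Bool) (c : ℚ) (n : ℤ) :
    n • (QuotientAddGroup.mk (zWord N ε c) : KZ.FormalRep ⧸ KZ.relations) =
      QuotientAddGroup.mk (zWord N ε (n * c)) := by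
  obtain ⟨k, rfl | rfl⟩ := Int.eq_nat_or_neg n
  · rw [natCast_zsmul, nsmul_mk_zWord, Int.cast_natCast]
  · rw [neg_zsmul, natCast_zsmul, nsmul_mk_zWord, Int.cast_neg, Int.cast_natCast, neg_mul]
    have h := mk_zWord_add ε ((k : ℚ) * c) (-((k : ℚ) * c))
    rw [add_neg_cancel, mk_zWord_zero] at h
    exact neg_eq_of_add_eq_zero_right h.symm

/-- An index of weight `N` with a given admissible word. -/
theorem exists_index' {N : ℕ} (ε : Fin N → Bool) (hε : Adm ε) :
    ∃ u : List ℕ, MZV.IsAdmissible u ∧ MZV.weight u = N ∧ bword N u = ε := by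
  rcases Nat.eq_zero_or_pos N with rfl | hN
  · exact ⟨[], MZV.isAdmissible_nil, rfl, funext fun i => i.elim0⟩
  · obtain ⟨u, hu, huw, hb⟩ := exists_index_of_adm hN ε hε
    refine ⟨u, hu, huw, funext fun i => ?_⟩
    simp [bword, wordOf, hb, List.getD_eq_getElem?_getD, i.isLt]

/-- **Descent.** Formal Hoffman spanning in `P_ℚ` (weight kept) gives the weight-`N` slice of the
crux: clear denominators, pull back along `P ↪ P_ℚ` (`IntegerDivision`), rescale by `q` (`scaleQ`),
divide by the common denominator (`IntegerDivision`), pass to an arbitrary generator by off-domain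
freedom; a non-admissible word carries no representation (`Negative/Divergence`). -/
theorem spanAt_of_formalSpanW {N : ℕ}
    (h : ∀ s : List ℕ, MZV.IsAdmissible s → MZV.weight s = N →
      toPeriodAlgebra (mzvClass s) ∈ Submodule.span ℚ (Set.range
        (fun t : {t : List ℕ // MZV.IsHoffman t ∧ MZV.weight t = MZV.weight s} =>
          toPeriodAlgebra (mzvClass t.1)))) :
    SpanAt N := by
  classical
  intro ε q s hd hi
  by_cases hε : Adm ε
  swap
  · exact ⟨0, zero_mem _, by simpa using of_mem_relations_of_not_adm s hd hi hε⟩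
  obtain ⟨sidx, hadm, hsw, hbw⟩ := exists_index' ε hε
  subst hsw
  obtain ⟨c, hc⟩ := (Finsupp.mem_span_range_iff_exists_finsupp).1 (h sidx hadm rfl)
  obtain ⟨D, hD, hden⟩ := exists_common_den c.support (fun t => c t)
  choose! a ha using hden
  have hD' : (D : ℚ) ≠ 0 := by exact_mod_cast hD.ne'
  -- the identity in `P`: `D • ⟦ζ(sidx)⟧ = Σ_t a_t • ⟦ζ(t)⟧`
  have hPid : (D : ℤ) • mzvClass sidx = ∑ t ∈ c.support, a t • mzvClass t.1 := by
    apply sectorKernel_toPeriodAlgebra_injective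
    rw [map_zsmul, map_sum, ← hc, Finsupp.sum, Finset.smul_sum]
    refine Finset.sum_congr rfl fun t ht => ?_
    rw [map_zsmul, ← Int.cast_smul_eq_zsmul ℚ (D : ℤ), smul_smul, ← Int.cast_smul_eq_zsmul ℚ (a t),
      ha t ht, Int.cast_natCast]
  -- the same identity as a relation in `KZ.FormalRep`
  have hcls : ∀ (u : List ℕ) (hu : MZV.IsAdmissible u), mzvClass u = toFormalPeriod (zIdx u 1) :=
    fun u hu => by rw [mzvClass_of_isAdmissible hu, zIdx_one_eq_of_mzvRep u hu]
  have hrel : (D : ℤ) • zIdx sidx 1 - ∑ t ∈ c.support, a t • zIdx t.1 1 ∈ KZ.relations := by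
    rw [← toFormalPeriod_eq_zero_iff, map_sub, map_zsmul, map_sum, sub_eq_zero, ← hcls sidx hadm, hPid]
    exact Finset.sum_congr rfl fun t _ => by rw [map_zsmul, ← hcls t.1 t.2.1.isAdmissible]
  -- pass to the quotient group and rescale by `q`
  have hQ : (D : ℤ) • (QuotientAddGroup.mk (zIdx sidx 1) : KZ.FormalRep ⧸ KZ.relations) =
      ∑ t ∈ c.support, a t • (QuotientAddGroup.mk (zIdx t.1 1) : KZ.FormalRep ⧸ KZ.relations) := by
    have := (QuotientAddGroup.eq_iff_sub_mem).mpr hrel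
    simpa only [QuotientAddGroup.mk_zsmul, QuotientAddGroup.mk_sum] using this
  have hQq := congrArg (scaleQ q) hQ
  rw [map_zsmul, map_sum] at hQq
  simp only [map_zsmul, zIdx, scaleQ_mk_zWord, mul_one] at hQq
  -- the Hoffman combination
  set m : KZ.FormalRep :=
    ∑ t ∈ c.support, zWord (MZV.weight sidx) (bword (MZV.weight sidx) t.1) ((a t : ℚ) * q / D) with hm
  have hmQ : (D : ℤ) • (QuotientAddGroup.mk m : KZ.FormalRep ⧸ KZ.relations) =
      ∑ t ∈ c.support, a t • (QuotientAddGroup.mk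
        (zWord (MZV.weight t.1) (bword (MZV.weight t.1) t.1) q) : KZ.FormalRep ⧸ KZ.relations) := by
    rw [hm, QuotientAddGroup.mk_sum, Finset.smul_sum]
    refine Finset.sum_congr rfl fun t _ => ?_
    rw [zsmul_mk_zWord, zsmul_mk_zWord, zWord_bword_eq_zIdx t.2.2]
    simp only [zIdx]
    congr 2
    push_cast
    rw [mul_div_assoc', mul_comm (D : ℚ) _, mul_div_assoc, div_self hD', mul_one]
  have hsQ : (QuotientAddGroup.mk (zWord (MZV.weight sidx) (bword (MZV.weight sidx) sidx) q) :
      KZ.FormalRep ⧸ KZ.relations) = QuotientAddGroup.mk (zWord (MZV.weight sidx) ε q) := by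
    rw [hbw]
  have hdiff : (D : ℤ) • ((QuotientAddGroup.mk (zWord (MZV.weight sidx) ε q) :
      KZ.FormalRep ⧸ KZ.relations) - QuotientAddGroup.mk m) = 0 := by
    rw [smul_sub, ← hsQ, hQq, hmQ, sub_self]
  have hrel' : (D : ℕ) • (zWord (MZV.weight sidx) ε q - m) ∈ KZ.relations := by
    rw [← natCast_zsmul, ← QuotientAddGroup.eq_zero_iff, QuotientAddGroup.mk_zsmul,
      QuotientAddGroup.mk_sub]
    exact hdiff
  have hrel'' : zWord (MZV.weight sidx) ε q - m ∈ KZ.relations :=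
    Summit.KontsevichZagierPeriods.FurushoPentagon.integerDivision_proof _ D hD hrel'
  refine ⟨m, ?_, ?_⟩
  · rw [hm]
    refine sum_mem fun t _ => AddSubgroup.subset_closure ?_
    exact zWord_bword_mem_hoffmanGens t.2.1 t.2.2 _
  · have h1 : KZ.of s - KZ.of (wordRep ε q hε) ∈ KZ.relations :=
      of_sub_of_wordRep_mem_relations hε s hd hi
    rw [zWord_of_adm hε] at hrel''
    have : KZ.of s - m = (KZ.of s - KZ.of (wordRep ε q hε)) + (KZ.of (wordRep ε q hε) - m) := by abel
    rw [this]
    exact add_mem h1 hrel''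

/-! ## Composition -/

/-- **The bridge of the line, PROVED**: under `PentagonInKZ` and `LeafTransfer`, the associator leaf
at every admissible index gives every weight slice of the crux — no hypothesis on the period ring. -/
theorem bridge (hP : PentagonInKZ) (hT : LeafTransfer)
    (hA : ∀ s : List ℕ, MZV.IsAdmissible s → LeafAt s) : ∀ N : ℕ, SpanAt N :=
  fun _ => spanAt_of_formalSpanW fun s hs _ => formalSpanW_of_leafAt hP hT hs (hA s hs)

/-- The leaf in every weight: tree theorem for weights `≤ 17`, the tail stub beyond. -/
theorem leafAt_all
    (hT : ∀ s : List ℕ, MZV.IsAdmissible s → 18 ≤ MZV.weight s → LeafAt s) :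
    ∀ s : List ℕ, MZV.IsAdmissible s → LeafAt s := by
  intro s hs
  by_cases h : MZV.weight s ≤ 17
  · exact stub_associatorHoffmanSpanning_of_weight_le_17 s hs h
  · exact hT s hs (by omega)

/-- **The crux from the stub statements** (sorry-free composition): a kernel-checked DECOMPOSITION
`LeafTransfer → (associator leaf in weights ≥ 18) → PentagonInKZ → HoffmanSpanInKZ`. -/
theorem HoffmanSpanInKZ_of_stubs
    (h₁ : LeafTransfer)
    (h₂ : ∀ s : List ℕ, MZV.IsAdmissible s → 18 ≤ MZV.weight s → LeafAt s)
    (h₃ : PentagonInKZ) :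
    HoffmanSpanInKZ :=
  hoffmanSpanInKZ_iff.mpr (bridge h₃ h₁ (leafAt_all h₂))

/-- **The crux** `HoffmanSpanInKZ`, by name, from the three stubs. -/
theorem HoffmanSpanInKZ_of : HoffmanSpanInKZ :=
  HoffmanSpanInKZ_of_stubs stub_leafTransfer stub_assocTailT stub_pentagonInKZ

end Summit.KontsevichZagierPeriods.KontsevichZagierPeriods.Cruxes.HoffmanSpanInKZ.AssocSmooth
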